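import Summits.CriticalPhenomena.SAWScalingLimit.Theorems.SAWRenewalTightnessAnnularMassDecayFirstDescentFactorisation

/-!
# The skip family versus the crux's first-entry family (line `radial-renewal-kesten-inequality`, stub S3)

Line `radial-renewal-kesten-inequality` of the crux `AnnularMassDecay` (stmt-CriticalPhenomena-4729),
support for the OPEN stub S3 `stub_skipTail`.  Notation as in the registered stubs (all sums spelled
out over `SAW.Zd.saws`, `SAW.criticalFugacity`, `Site.toComplex`; no definitions here): centre `z`,
start `u`, `ρ_u = dist (Site.toComplex u) z`; `Skip(u;A,s)[N]` = `x_c`-mass of the level-`ρ_u/A`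
chain-stopped members from `u` (length `0 < n ≤ N`, confined to the open disc of radius `ρ_u` about
`z` after time `0`, end = strict radial record of radius `≤ ρ_u/A`, no radial renewal time of radius
`≤ ρ_u/A` before the end) whose END radius is `≤ s`; and the CRUX's own family
`annMass z s ρ_u u N` (`Theorems/AnnularMassDecay/Negative/LoadBearing`): walks from `u` whose
interior vertices lie in the open annulus `s < |· - z| < ρ_u` and whose end lies in `|· - z| ≤ s`
(FIRST ENTRY into the closed `s`-disc).  The combinatorial relation between the two, proved here:

* A skipping member `ω` with end radius `≤ s ≤ ρ_u/A` enters the closed `s`-disc for the first time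
  at a time `0 < t₁ ≤ n`.  If `t₁ = n` it IS an annular bridge of `annMass z s ρ_u u N`
  (`rr_st_profile_bridge`).  If `t₁ < n` ("RE-ENTRANT member") then `t₁` is a strict radial record of
  radius `≤ s ≤ ρ_u/A`, so by the no-renewal clause its future is NOT entirely closer: the walk
  RETURNS to radius `≥ |ω_{t₁} - z|` at some time `t₁ < j < n` before descending to its end radius
  `|ω_n - z| < |ω_{t₁} - z|` (`rr_st_profile_suffix`).  Re-entrant members exist (e.g. `z = 0`,
  `u = (4,0)`, `A = B = 2`, `s = 1`: `(4,0)→(3,0)→(2,0)→(1,0)→(1,1)→(1,2)→(0,2)→(0,1)→(0,0)` is a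
  skipping member — its records `(2,0)`, `(1,0)` are undone by `(1,2)` — which visits radius `1 = s`
  twice before its end, so it lies in NO annular family `annMass z s' R u N` with `s' ≥ 1`): the skip
  family is not contained in any first-entry family the crux controls, and no domination
  `Skip ≤ annMass` follows from an inclusion.
* `rr_st_firstEntry_factorisation` — the exact cut at `t₁` (same split as `SAW.Zd.count_add_le`,
  through `rr_fd_abstract_factorisation`): for `A > 1`, `s ≤ ρ_u/A`,
  `Skip(u;A,s)[N] ≤ Σ_{m ≤ N} Σ_{β} x_c^m · Ret(u + β_m; s)[N] + annMass z s ρ_u u N`, where `β` runs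
  over the annular bridges of `annMass z s ρ_u u` of length `m` and `Ret(w;s)[N]` is the `x_c`-mass
  of the RETURNING RECORD-ENDING DESCENTS from `w`: walks `τ` of length `0 < k ≤ N` from `w`, confined
  to the open disc of radius `ρ_u`, whose end is a strict radial record (over `τ`, so of radius
  `< |w - z|`) of radius `≤ s`, and which reach radius `≥ |w - z|` at some time `0 < j < k`.
* `rr_st_skipTail_of_annularDecay` (registered helper) — hence S3 follows, with `κ = θ`, from the
  crux-type decay `annMass z r R u N ≤ C (r/R)^θ` (`1 ≤ r < R ≤ ρ_u`; used only at `R = ρ_u`,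
  `r = ρ_u/(AB) ≥ 1`) TOGETHER WITH a uniform bound `Ret(w;s)[N] ≤ K` (`1 ≤ s`, `|w - z| ≤ s < ρ`) on
  the returning record-ending descents — an S1-type boundedness statement for an unconfined
  critical `x_c`-mass, itself open.  (The companion file `…SkipStructure` shows the sharper fact
  that S3 already follows from the line's target `ChainDecay`, with no extra hypothesis.)

Sources: H. Kesten, J. Math. Phys. 4 (1963); N. Madras, G. Slade, *The Self-Avoiding Walk* (1993)
§1.2, §4.2. [folklore]
-/

noncomputable section

namespace Summit.CriticalPhenomena.SAWScalingLimit.Theorems.AnnularMassDecay.Radial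

open scoped BigOperators Classical
open Literature.Probability.LatticeModels Literature.Probability.RandomPlanarGeometry
open Summit.CriticalPhenomena.SAWScalingLimit.Theorems.AnnularMassDecay.Negative (criticalFugacity_pos)

/-! ### Radius profiles: the first-entry cut -/

/-- **No entry before the end.** A skipping profile (renewal level `L`, end radius `≤ s`) none of
whose times `0 < t < n` has radius `≤ s` is an annular bridge for the annulus `(s, ρ)`. [folklore] -/
theorem rr_st_profile_bridge {r : ℕ → ℝ} {ρ s L : ℝ} {n : ℕ}
    (h : r n ≤ s ∧ 0 < n ∧ (∀ i, 0 < i → i ≤ n → r i < ρ) ∧ (∀ i, i < n → r n < r i) ∧ r n ≤ L ∧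
      (∀ t, 0 < t → t < n → (∀ i, i < t → r t < r i) →
        (∀ j, t < j → j ≤ n → r j < r t) → L < r t))
    (hno : ∀ t, ¬ (0 < t ∧ t < n ∧ r t ≤ s)) :
    (∀ i, 0 < i → i < n → s < r i ∧ r i < ρ) ∧ r n ≤ s := by
  obtain ⟨hns, -, hconf, -, -, -⟩ := h
  refine ⟨fun i hi0 hin => ⟨?_, hconf i hi0 hin.le⟩, hns⟩
  by_contra hle
  exact hno i ⟨hi0, hin, not_lt.1 hle⟩

/-- **Prefix of the first-entry cut.** If `t < n` is the least time `0 < t` of radius `≤ s` of a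
profile confined below `ρ` after time `0`, a profile `r'` agreeing with `r` on `[0, t]` is an
annular bridge of length `t` for the annulus `(s, ρ)`. [folklore] -/
theorem rr_st_profile_prefix {r r' : ℕ → ℝ} {ρ s : ℝ} {n t : ℕ}
    (hconf : ∀ i, 0 < i → i ≤ n → r i < ρ) (htn : t < n) (ht : r t ≤ s)
    (hmin : ∀ t', t' < t → ¬ (0 < t' ∧ t' < n ∧ r t' ≤ s)) (hr' : ∀ i, i ≤ t → r' i = r i) :
    (∀ i, 0 < i → i < t → s < r' i ∧ r' i < ρ) ∧ r' t ≤ s := by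
  refine ⟨fun i hi0 hit => ?_, by rw [hr' t le_rfl]; exact ht⟩
  rw [hr' i hit.le]
  refine ⟨?_, hconf i hi0 (hit.le.trans htn.le)⟩
  by_contra hle
  exact hmin i hit ⟨hi0, hit.trans htn, not_lt.1 hle⟩

/-- **Suffix of the first-entry cut: a returning record-ending descent.** `r`: a skipping profile
(renewal level `L`, end radius `≤ s`, `s ≤ L`, start radius `ρ`); `t`: the least time `0 < t < n` of
radius `≤ s`.  A profile `r''` with `r'' i = r (t + i)` on `[0, n - t]` has positive length, is
confined below `ρ`, ends at a strict record of radius `≤ s`, and reaches radius `≥ ρw = r t` at some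
time `0 < j < n - t`: `t` is a strict record of radius `≤ L`, so (no renewal) its future is not
entirely closer, and the end is closer. [folklore] -/
theorem rr_st_profile_suffix {r r'' : ℕ → ℝ} {ρ s L ρw : ℝ} {n t : ℕ}
    (h : r n ≤ s ∧ 0 < n ∧ (∀ i, 0 < i → i ≤ n → r i < ρ) ∧ (∀ i, i < n → r n < r i) ∧ r n ≤ L ∧
      (∀ t, 0 < t → t < n → (∀ i, i < t → r t < r i) →
        (∀ j, t < j → j ≤ n → r j < r t) → L < r t))
    (hsL : s ≤ L) (h0 : r 0 = ρ) (ht0 : 0 < t) (htn : t < n) (ht : r t ≤ s)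
    (hmin : ∀ t', t' < t → ¬ (0 < t' ∧ t' < n ∧ r t' ≤ s)) (hρw : ρw = r t)
    (hr'' : ∀ i, i ≤ n - t → r'' i = r (t + i)) :
    0 < n - t ∧ (∀ i, i ≤ n - t → r'' i < ρ) ∧ (∀ i, i < n - t → r'' (n - t) < r'' i) ∧
      r'' (n - t) ≤ s ∧ (∃ j, 0 < j ∧ j < n - t ∧ ρw ≤ r'' j) := by
  obtain ⟨hns, -, hconf, hrec, -, hren⟩ := h
  have hm : r'' (n - t) = r n := by rw [hr'' _ le_rfl, Nat.add_sub_of_le htn.le]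
  refine ⟨Nat.sub_pos_of_lt htn, ?_, ?_, hm ▸ hns, ?_⟩
  · intro i hi
    rw [hr'' i hi]
    exact hconf (t + i) (by omega) (by omega)
  · intro i hi
    rw [hm, hr'' i hi.le]
    exact hrec (t + i) (by omega)
  · -- `t` is a strict record of radius `≤ s ≤ L`; no renewal there, and the end is closer
    have hrect : ∀ i, i < t → r t < r i := by
      intro i hit
      rcases Nat.eq_zero_or_pos i with rfl | hi0
      · rw [h0]
        exact hconf t ht0 htn.le
      · by_contra hle
        exact hmin i hit ⟨hi0, hit.trans htn, (not_lt.1 hle).trans ht⟩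
    have hnot : ¬ ∀ j, t < j → j ≤ n → r j < r t := by
      intro hF
      have := hren t ht0 htn hrect hF
      linarith
    push Not at hnot
    obtain ⟨j, htj, hjn, hj⟩ := hnot
    have hjn' : j < n := by
      rcases hjn.lt_or_eq with hlt | rfl
      · exact hlt
      · exact absurd (hrec t htn) (not_lt.2 hj)
    refine ⟨j - t, by omega, by omega, ?_⟩
    rw [hρw, hr'' (j - t) (by omega), Nat.add_sub_cancel' htj.le]
    exact hj

/-! ### The first-entry factorisation of the skip mass -/

/-- **First-entry factorisation of the skip mass.**  For `A > 1`, a centre `z`, a start `u`, a level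
`s ≤ dist (Site.toComplex u) z / A` and `N`: cutting a skipping member at its first entry `t₁` into
the closed `s`-disc gives either the member itself (`t₁ = n`: an annular bridge of the crux's family
`annMass z s (dist (Site.toComplex u) z) u N`, the last sum) or an annular bridge `β` of length
`m = t₁` followed by a returning record-ending descent from `u + β m` (the inner sum: length
`0 < k ≤ N`, confined to the open disc of radius `dist (Site.toComplex u) z`, end = strict record of
radius `≤ s`, radius `≥ dist (Site.toComplex (u + β m)) z` reached at some `0 < j < k`); the cut is
injective and the weights multiply, whence the inequality. [folklore] -/
theorem rr_st_firstEntry_factorisation :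
    ∀ A : ℝ, 1 < A → ∀ (z : ℂ) (u : Site 2) (s : ℝ), s ≤ dist (Site.toComplex u) z / A → ∀ N : ℕ,
      (∑ n ∈ Finset.range (N + 1),
        ∑ _ω ∈ (SAW.Zd.saws 2 n).filter (fun ω =>
          dist (Site.toComplex (u + ω n)) z ≤ s ∧
          0 < n ∧
          (∀ i, 0 < i → i ≤ n → dist (Site.toComplex (u + ω i)) z < dist (Site.toComplex u) z) ∧
          (∀ i, i < n → dist (Site.toComplex (u + ω n)) z < dist (Site.toComplex (u + ω i)) z) ∧
          dist (Site.toComplex (u + ω n)) z ≤ dist (Site.toComplex u) z / A ∧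
          (∀ t, 0 < t → t < n →
            (∀ i, i < t → dist (Site.toComplex (u + ω t)) z < dist (Site.toComplex (u + ω i)) z) →
            (∀ j, t < j → j ≤ n → dist (Site.toComplex (u + ω j)) z < dist (Site.toComplex (u + ω t)) z) →
            dist (Site.toComplex u) z / A < dist (Site.toComplex (u + ω t)) z)),
          SAW.criticalFugacity ^ n) ≤
      (∑ m ∈ Finset.range (N + 1),
        ∑ η ∈ (SAW.Zd.saws 2 m).filter (fun η =>
            (∀ i, 0 < i → i < m → s < dist (Site.toComplex (u + η i)) z ∧
              dist (Site.toComplex (u + η i)) z < dist (Site.toComplex u) z) ∧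
            dist (Site.toComplex (u + η m)) z ≤ s),
          SAW.criticalFugacity ^ m *
            (∑ k ∈ Finset.range (N + 1),
                ∑ _τ ∈ (SAW.Zd.saws 2 k).filter (fun τ =>
                  0 < k ∧
                  (∀ i, i ≤ k → dist (Site.toComplex (u + η m + τ i)) z < dist (Site.toComplex u) z) ∧
                  (∀ i, i < k → dist (Site.toComplex (u + η m + τ k)) z <
                    dist (Site.toComplex (u + η m + τ i)) z) ∧
                  dist (Site.toComplex (u + η m + τ k)) z ≤ s ∧
                  (∃ j, 0 < j ∧ j < k ∧ dist (Site.toComplex (u + η m)) z ≤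
                    dist (Site.toComplex (u + η m + τ j)) z)),
                  SAW.criticalFugacity ^ k)) +
      (∑ n ∈ Finset.range (N + 1),
        ∑ _ω ∈ (SAW.Zd.saws 2 n).filter (fun ω =>
          (∀ i, 0 < i → i < n → s < dist (Site.toComplex (u + ω i)) z ∧
            dist (Site.toComplex (u + ω i)) z < dist (Site.toComplex u) z) ∧
          dist (Site.toComplex (u + ω n)) z ≤ s),
          SAW.criticalFugacity ^ n) := by
  intro A _ z u s hs N
  refine rr_fd_abstract_factorisation (α := ℕ → Site 2) criticalFugacity_pos.le N (SAW.Zd.saws 2)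
    _ _ _ _ (fun n ω t => 0 < t ∧ t < n ∧ dist (Site.toComplex (u + ω t)) z ≤ s)
    (fun _ ω t => fun i => ω (min i t)) (fun n ω t => fun i => ω (t + min i (n - t)) - ω t)
    ?_ ?_ ?_
  · -- no entry before the end: an annular bridge
    intro n ω _ hC hno
    exact rr_st_profile_bridge (r := fun k => dist (Site.toComplex (u + ω k)) z) hC hno
  · -- the cut at the first entry
    intro n ω t hω hC hgood hmin
    obtain ⟨ht0, htn, hts⟩ := hgood
    have h0 : dist (Site.toComplex (u + ω 0)) z = dist (Site.toComplex u) z := by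
      rw [(SAW.Zd.mem_saws.1 hω).1, add_zero]
    refine ⟨htn.le, rr_fd_prefix_mem_saws hω htn.le, ?_, rr_fd_suffix_mem_saws hω htn.le, ?_⟩
    · exact rr_st_profile_prefix (r := fun k => dist (Site.toComplex (u + ω k)) z)
        (r' := fun i => dist (Site.toComplex (u + ω (min i t))) z) hC.2.2.1 htn hts hmin
        (fun i hi => by simp only [min_eq_left hi])
    · exact rr_st_profile_suffix (r := fun k => dist (Site.toComplex (u + ω k)) z)
        (r'' := fun i =>
          dist (Site.toComplex (u + ω (min t t) + (ω (t + min i (n - t)) - ω t))) z)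
        (ρw := dist (Site.toComplex (u + ω (min t t))) z)
        hC hs h0 ht0 htn hts hmin (by simp only [min_self])
        (fun i hi => by simp only [min_self, min_eq_left hi, add_add_sub_cancel])
  · -- injectivity of the cut
    exact fun t n ω n' ω' hω hω' htn htn' h1 h2 h3 => rr_fd_cut_injective hω hω' htn htn' h1 h2 h3

/-! ### S3 from crux-type decay and boundedness of the returning descents -/

/-- **`AnnularMassDecay ∧ RetBounded ⟹ SkipTail`** (registered helper
`rr_st_skipTail_of_annularDecay` for `stub_skipTail`).  Hypotheses: (i) the crux-type decay of the
first-entry annular mass, verbatim the crux `AnnularMassDecay` (`annMass z r R u N ≤ C (r/R)^θ` for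
`1 ≤ r < R ≤ dist (Site.toComplex u) z`); (ii) a uniform bound `K` on the `x_c`-mass of returning
record-ending descents from `w` (confined to the open `ρ`-disc about `z`, end = strict record of
radius `≤ s`, radius `≥ dist (Site.toComplex w) z` reached before the end) for `1 ≤ s`,
`dist (Site.toComplex w) z ≤ s < ρ`.  Conclusion: S3 verbatim, with `κ = θ` and constant
`(max K 0 + 1) · max C 0`: by `rr_st_firstEntry_factorisation` at `s = dist (Site.toComplex u) z /
(A·B)`, `Skip ≤ (max K 0 + 1) · annMass z s (dist (Site.toComplex u) z) u N ≤ (max K 0 + 1) · C ·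
(A·B)^{-θ}`.  Both hypotheses are open (critical `x_c`-masses on `ℤ²`); (i) is the crux itself, so
this records the logical position of S3, not a route to it. [folklore] -/
theorem rr_st_skipTail_of_annularDecay :
    (∃ θ C : ℝ, 0 < θ ∧ ∀ (z : ℂ) (r R : ℝ), 1 ≤ r → r < R → ∀ u : Site 2,
      R ≤ dist (Site.toComplex u) z → ∀ N : ℕ,
      (∑ n ∈ Finset.range (N + 1),
        ∑ _ω ∈ (SAW.Zd.saws 2 n).filter (fun ω =>
          (∀ i, 0 < i → i < n → r < dist (Site.toComplex (u + ω i)) z ∧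
            dist (Site.toComplex (u + ω i)) z < R) ∧
          dist (Site.toComplex (u + ω n)) z ≤ r),
          SAW.criticalFugacity ^ n) ≤ C * (r / R) ^ θ) →
    (∃ K : ℝ, ∀ (z : ℂ) (w : Site 2) (ρ s : ℝ) (N : ℕ), 1 ≤ s → dist (Site.toComplex w) z ≤ s →
      s < ρ →
      (∑ k ∈ Finset.range (N + 1),
        ∑ _τ ∈ (SAW.Zd.saws 2 k).filter (fun τ =>
          0 < k ∧
          (∀ i, i ≤ k → dist (Site.toComplex (w + τ i)) z < ρ) ∧
          (∀ i, i < k → dist (Site.toComplex (w + τ k)) z < dist (Site.toComplex (w + τ i)) z) ∧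
          dist (Site.toComplex (w + τ k)) z ≤ s ∧
          (∃ j, 0 < j ∧ j < k ∧ dist (Site.toComplex w) z ≤ dist (Site.toComplex (w + τ j)) z)),
          SAW.criticalFugacity ^ k) ≤ K) →
    ∀ A : ℝ, 1 < A → ∃ κ C : ℝ, 0 < κ ∧ ∀ B : ℝ, 1 ≤ B → ∀ (z : ℂ) (u : Site 2),
      A * B ≤ dist (Site.toComplex u) z → ∀ N : ℕ,
      (∑ n ∈ Finset.range (N + 1),
        ∑ _ω ∈ (SAW.Zd.saws 2 n).filter (fun ω =>
          dist (Site.toComplex (u + ω n)) z ≤ dist (Site.toComplex u) z / (A * B) ∧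
          0 < n ∧
          (∀ i, 0 < i → i ≤ n → dist (Site.toComplex (u + ω i)) z < dist (Site.toComplex u) z) ∧
          (∀ i, i < n → dist (Site.toComplex (u + ω n)) z < dist (Site.toComplex (u + ω i)) z) ∧
          dist (Site.toComplex (u + ω n)) z ≤ dist (Site.toComplex u) z / A ∧
          (∀ t, 0 < t → t < n →
            (∀ i, i < t → dist (Site.toComplex (u + ω t)) z < dist (Site.toComplex (u + ω i)) z) →
            (∀ j, t < j → j ≤ n → dist (Site.toComplex (u + ω j)) z < dist (Site.toComplex (u + ω t)) z) →
            dist (Site.toComplex u) z / A < dist (Site.toComplex (u + ω t)) z)),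
          SAW.criticalFugacity ^ n) ≤ C * B ^ (-κ) := by
  rintro ⟨θ, C, hθ, hD⟩ ⟨K, hK⟩ A hA
  refine ⟨θ, (max K 0 + 1) * max C 0, hθ, fun B hB z u hAB N => ?_⟩
  have hABpos : 0 < A * B := by positivity
  have hB0 : 0 < B := by linarith
  have hρpos : 0 < dist (Site.toComplex u) z := lt_of_lt_of_le hABpos hAB
  have hAB1 : 1 < A * B := by nlinarith
  have hs1 : 1 ≤ dist (Site.toComplex u) z / (A * B) := by rwa [le_div_iff₀ hABpos, one_mul]
  have hslt : dist (Site.toComplex u) z / (A * B) < dist (Site.toComplex u) z :=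
    div_lt_self hρpos hAB1
  have hsle : dist (Site.toComplex u) z / (A * B) ≤ dist (Site.toComplex u) z / A :=
    div_le_div_of_nonneg_left hρpos.le (by linarith) (by nlinarith)
  have hx : 0 ≤ SAW.criticalFugacity := criticalFugacity_pos.le
  -- the crux-type decay at `R = dist (Site.toComplex u) z`, `r = dist (Site.toComplex u) z / (A * B)`
  have hann := hD z (dist (Site.toComplex u) z / (A * B)) (dist (Site.toComplex u) z) hs1 hslt u
    le_rfl N
  have hcmp : C * (dist (Site.toComplex u) z / (A * B) / dist (Site.toComplex u) z) ^ θ ≤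
      max C 0 * B ^ (-θ) := by
    have hq : dist (Site.toComplex u) z / (A * B) / dist (Site.toComplex u) z = (A * B)⁻¹ := by
      field_simp
    rw [hq, Real.inv_rpow hABpos.le, ← Real.rpow_neg hABpos.le]
    calc C * (A * B) ^ (-θ) ≤ max C 0 * (A * B) ^ (-θ) :=
          mul_le_mul_of_nonneg_right (le_max_left _ _) (Real.rpow_nonneg hABpos.le _)
      _ ≤ max C 0 * B ^ (-θ) :=
          mul_le_mul_of_nonneg_left
            (Real.rpow_le_rpow_of_nonpos hB0 (by nlinarith) (by linarith)) (le_max_right _ _)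
  refine (rr_st_firstEntry_factorisation A hA z u _ hsle N).trans ?_
  -- bound every returning-descent factor by `max K 0`
  have hmain : ∀ (m : ℕ) (η : ℕ → Site 2), η ∈ (SAW.Zd.saws 2 m).filter (fun η =>
        (∀ i, 0 < i → i < m → dist (Site.toComplex u) z / (A * B) < dist (Site.toComplex (u + η i)) z ∧
          dist (Site.toComplex (u + η i)) z < dist (Site.toComplex u) z) ∧
        dist (Site.toComplex (u + η m)) z ≤ dist (Site.toComplex u) z / (A * B)) →
      SAW.criticalFugacity ^ m *
        (∑ k ∈ Finset.range (N + 1),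
          ∑ _τ ∈ (SAW.Zd.saws 2 k).filter (fun τ =>
            0 < k ∧
            (∀ i, i ≤ k → dist (Site.toComplex (u + η m + τ i)) z < dist (Site.toComplex u) z) ∧
            (∀ i, i < k → dist (Site.toComplex (u + η m + τ k)) z <
              dist (Site.toComplex (u + η m + τ i)) z) ∧
            dist (Site.toComplex (u + η m + τ k)) z ≤ dist (Site.toComplex u) z / (A * B) ∧
            (∃ j, 0 < j ∧ j < k ∧ dist (Site.toComplex (u + η m)) z ≤
              dist (Site.toComplex (u + η m + τ j)) z)),
            SAW.criticalFugacity ^ k) ≤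
      SAW.criticalFugacity ^ m * max K 0 := by
    intro m η hη
    have hend := (Finset.mem_filter.1 hη).2.2
    exact mul_le_mul_of_nonneg_left
      ((hK z (u + η m) (dist (Site.toComplex u) z) _ N hs1 hend hslt).trans (le_max_left _ _))
      (pow_nonneg hx m)
  have hsum := Finset.sum_le_sum fun m (_ : m ∈ Finset.range (N + 1)) =>
    Finset.sum_le_sum fun η hη => hmain m η hη
  refine (add_le_add hsum hann).trans ?_
  have hfac : ∀ (S : ℕ → Finset (ℕ → Site 2)),
      (∑ m ∈ Finset.range (N + 1), ∑ _η ∈ S m, SAW.criticalFugacity ^ m * max K 0) =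
        max K 0 * ∑ m ∈ Finset.range (N + 1), ∑ _η ∈ S m, SAW.criticalFugacity ^ m := by
    intro S
    rw [Finset.mul_sum]
    refine Finset.sum_congr rfl fun m _ => ?_
    rw [Finset.mul_sum]
    exact Finset.sum_congr rfl fun _ _ => mul_comm _ _
  rw [hfac]
  have hK0 : 0 ≤ max K 0 + 1 := by positivity
  calc _ ≤ max K 0 * (C * (dist (Site.toComplex u) z / (A * B) / dist (Site.toComplex u) z) ^ θ) +
        C * (dist (Site.toComplex u) z / (A * B) / dist (Site.toComplex u) z) ^ θ :=
        add_le_add (mul_le_mul_of_nonneg_left hann (le_max_right _ _)) le_rfl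
    _ = (max K 0 + 1) *
        (C * (dist (Site.toComplex u) z / (A * B) / dist (Site.toComplex u) z) ^ θ) := by ring
    _ ≤ (max K 0 + 1) * (max C 0 * B ^ (-θ)) := mul_le_mul_of_nonneg_left hcmp hK0
    _ = (max K 0 + 1) * max C 0 * B ^ (-θ) := by ring

end Summit.CriticalPhenomena.SAWScalingLimit.Theorems.AnnularMassDecay.Radial

end
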